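import Mathlib
import HarnessLib

/-!
# Cell pnp-psdrank, route `ChebyshevTracialDesign`: THE `HH`-CLASS WEIGHTS OF A SMALL BLOCK ARE POLYNOMIALS OF DEGREE `a`
# IN THE LEVEL, VANISHING AT THE VIRTUAL LEVEL ON EVERY CLASS WITH A HALF `HH`-EDGE (crux `TracialDecayExp20`, stmt-PneNP-19878)

Brick (T-K3a) (engine seat g24; eng MEMO-23 §2). For a block `H` whose matching has `a` internal (`HH`) edges, `b`
crossing edges and `d` outer edges (`N = a + b + d`), the shell law at cut `t = 2s + c`, level `c` splits along the
states of the `a` internal edges — `f` full, `g` half, `e = a − f − g` empty (the (K0) reduction of lit's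
`ShellLawPopulationMixture` §7): the class `(f,g)` has probability
`W_{fg}(s,c) = C(a,f)·C(a−f,g)·(s)_f·(c)_g·(N−s−c)_e/(N)_a` (multivariate hypergeometric) and, inside it, the block
statistic is `2f + g +` the statistic of the `a = 0` block `H` in the ground set with the `HH` class removed. AT FIXED
CUT `t` the weight is the value at `c` of the real polynomial
`p_{fg}(X) = κ·Π_{i<f}((t−X)/2 − i)·Π_{i<g}(X − i)·Π_{i<e}(N − (t+X)/2 − i)`, `κ = C(a,f)C(a−f,g)/(N)_a`, of degree `≤ a`:

* §1 `descFactorial_mul_descFactorial_le_add` (`(x)_f·(y)_g ≤ (x+y)_{f+g}`), `cast_descFactorial_eq_prod_range`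
  (`(n)_k = Π_{j<k}(n−j)` in `ℝ`, all `n, k`), `sum_choose_mul_choose_eq_three_pow` (`Σ_{f,g} C(a,f)C(a−f,g) = 3^a`).
* §2 the class-weight polynomial (always written out; no definition is introduced): **`natDegree_classWeight_le`**
  (`≤ f+g+e`), **`classWeight_eval_level`** (its value at a level `c` with `2s + c = t`, `s + c ≤ N` is `W_{fg}(s,c)`),
  **`classWeight_eval_eq_zero_of_lt`** (it VANISHES at every natural `c < g` — in particular at the virtual level
  `c = 0` whenever the class has a half `HH`-edge), **`classWeight_eval_zero_nonneg`** (for `g = 0` its value at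
  the virtual level is `≥ 0`), **`classWeight_eval_level_le`** (`0 ≤ W_{fg}(s,c) ≤ C(a,f)C(a−f,g)` on genuine levels).
READING (eng MEMO-23 §2): with the exact-design remainder for polynomially weighted profiles
(`Literature/Combinatorics/Optimization/ExactDesignWeightedRemainder`) this is why blocks WITH internal matching edges
are priced like blocks without: the classes with a half `HH`-edge carry ZERO virtual weight and are pure remainder, the
classes with only full/empty `HH`-edges reduce to (T-K)'s virtual positivity on the smaller ground set. The assembly
is brick (T-K3) `ChebyshevTracialDesignSmallBlockMaskPricingHH`.
WHAT THIS FILE DOES NOT DO: anything about shells (pure algebra); anything on `TracialDecayExp20` itself, psd rank of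
P_PM(K_n), or P vs NP. [cite: ChattamvelliShanmugam2020, §7.4 (multivariate hypergeometric law)]
[cite: Agarwal2000DifferenceEquations, Remark 1.8.1]
Stature: support/instrument (kernel lane, no defs, axioms standard). Supports stmt-PneNP-19878.
-/

set_option linter.dupNamespace false -- `Summit.PneNP.PneNP.…`: summit = sub-problem (D-0017)

noncomputable section

namespace Summit.PneNP.PneNP.Theorems.ChebyshevTracialDesignSmallBlockClassWeights

open Finset Polynomial

/-! ### §1 Falling factorials and the trinomial count -/

/-- `(x)_f · (y)_g ≤ (x+y)_{f+g}` (choose `f` then `g` ordered items from disjoint pools of sizes `x`, `y` versus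
`f+g` ordered items from the union). [cite: ChattamvelliShanmugam2020, §7.4 (multivariate hypergeometric law)] -/
theorem descFactorial_mul_descFactorial_le_add (x y f g : ℕ) :
    x.descFactorial f * y.descFactorial g ≤ (x + y).descFactorial (f + g) := by
  rcases lt_or_ge x f with hxf | hxf
  · rw [Nat.descFactorial_eq_zero_iff_lt.2 hxf, zero_mul]; exact Nat.zero_le _
  rw [← Nat.descFactorial_mul_descFactorial (n := x + y) (k := f) (m := f + g) (Nat.le_add_right f g),
    Nat.add_sub_cancel_left, mul_comm]
  exact Nat.mul_le_mul (Nat.descFactorial_le g (by omega)) (Nat.descFactorial_le f (Nat.le_add_right x y))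

/-- Three pools: `(x)_f · (y)_g · (z)_e ≤ (x+y+z)_{f+g+e}`. [cite: ChattamvelliShanmugam2020, §7.4 (multivariate hypergeometric law)] -/
theorem descFactorial_mul_mul_le_add (x y z f g e : ℕ) :
    x.descFactorial f * y.descFactorial g * z.descFactorial e ≤ (x + y + z).descFactorial (f + g + e) :=
  (Nat.mul_le_mul_right _ (descFactorial_mul_descFactorial_le_add x y f g)).trans
    (descFactorial_mul_descFactorial_le_add (x + y) z (f + g) e)

/-- `(n)_k = Π_{j<k} (n − j)` in `ℝ`, for ALL `n, k` (both sides vanish when `k > n`: the factor `j = n`).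
[cite: Agarwal2000DifferenceEquations, Remark 1.8.1] -/
theorem cast_descFactorial_eq_prod_range (n k : ℕ) :
    ((n.descFactorial k : ℕ) : ℝ) = ∏ j ∈ range k, ((n : ℝ) - j) := by
  rcases le_or_gt k n with h | h
  · rw [Nat.descFactorial_eq_prod_range, Nat.cast_prod]
    refine prod_congr rfl fun j hj => ?_
    have := mem_range.1 hj
    rw [Nat.cast_sub (by omega)]
  · rw [Nat.descFactorial_eq_zero_iff_lt.2 h, Nat.cast_zero, eq_comm]
    exact prod_eq_zero (mem_range.2 h) (by simp)

/-- The trinomial count of the `HH` classes: `Σ_{f ≤ a} Σ_{g ≤ a−f} C(a,f)·C(a−f,g) = 3^a`.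
[cite: ChattamvelliShanmugam2020, §7.4 (multivariate hypergeometric law)] -/
theorem sum_choose_mul_choose_eq_three_pow (a : ℕ) :
    ∑ f ∈ range (a + 1), ∑ g ∈ range (a - f + 1), ((a.choose f : ℕ) : ℝ) * ((a - f).choose g : ℕ) = (3 : ℝ) ^ a := by
  have h3 : (3 : ℝ) ^ a = ∑ f ∈ range (a + 1), (1 : ℝ) ^ f * (2 : ℝ) ^ (a - f) * (a.choose f : ℕ) := by
    rw [← add_pow]; norm_num
  rw [h3]
  refine sum_congr rfl fun f _ => ?_
  rw [← mul_sum, one_pow, one_mul, mul_comm]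
  congr 1
  have h2 := Nat.sum_range_choose (a - f)
  rw [← Nat.cast_sum, h2]
  push_cast
  ring

/-! ### §2 The class-weight polynomial -/

/-- **Degree**: `p_{fg}` has degree `≤ f + g + e`. [cite: Agarwal2000DifferenceEquations, Remark 1.8.1] -/
theorem natDegree_classWeight_le (κ T₀ M₀ : ℝ) (f g e : ℕ) :
    (C κ * (∏ i ∈ range f, (C (T₀ - i) - C (1 / 2 : ℝ) * X)) * (∏ i ∈ range g, (X - C (i : ℝ))) *
        (∏ i ∈ range e, (C (M₀ - i) - C (1 / 2 : ℝ) * X))).natDegree ≤ f + g + e := by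
  have hlin1 : ∀ (u : ℝ), (C u - C (1 / 2 : ℝ) * X).natDegree ≤ 1 := fun u =>
    (natDegree_sub_le _ _).trans (by
      refine max_le (by simp) ((natDegree_C_mul_le _ _).trans ?_)
      simp)
  have hlin2 : ∀ (u : ℝ), (X - C u).natDegree ≤ 1 := fun u => (natDegree_X_sub_C u).le
  have hP1 : (∏ i ∈ range f, (C (T₀ - i) - C (1 / 2 : ℝ) * X)).natDegree ≤ f := by
    refine (natDegree_prod_le _ _).trans ((sum_le_card_nsmul _ _ 1 fun i _ => hlin1 _).trans ?_)
    simp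
  have hP2 : (∏ i ∈ range g, (X - C (i : ℝ))).natDegree ≤ g := by
    refine (natDegree_prod_le _ _).trans ((sum_le_card_nsmul _ _ 1 fun i _ => hlin2 _).trans ?_)
    simp
  have hP3 : (∏ i ∈ range e, (C (M₀ - i) - C (1 / 2 : ℝ) * X)).natDegree ≤ e := by
    refine (natDegree_prod_le _ _).trans ((sum_le_card_nsmul _ _ 1 fun i _ => hlin1 _).trans ?_)
    simp
  refine natDegree_mul_le.trans (Nat.add_le_add (natDegree_mul_le.trans (Nat.add_le_add
    (natDegree_mul_le.trans ?_) hP2)) hP3)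
  rw [natDegree_C, zero_add]
  exact hP1

/-- **Value at a genuine level**: at `c` with `2s + c = t` and `s + c ≤ N`, with `T₀ = t/2`, `M₀ = N − t/2`:
`p_{fg}(c) = κ·(s)_f·(c)_g·(N−s−c)_e`. [cite: ChattamvelliShanmugam2020, §7.4 (multivariate hypergeometric law)] -/
theorem classWeight_eval_level (κ : ℝ) {N t s c : ℕ} (hsc : 2 * s + c = t) (hN : s + c ≤ N) (f g e : ℕ) :
    (C κ * (∏ i ∈ range f, (C ((t : ℝ) / 2 - i) - C (1 / 2 : ℝ) * X)) * (∏ i ∈ range g, (X - C (i : ℝ))) *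
        (∏ i ∈ range e, (C ((N : ℝ) - (t : ℝ) / 2 - i) - C (1 / 2 : ℝ) * X))).eval (c : ℝ) =
      κ * (s.descFactorial f : ℕ) * (c.descFactorial g : ℕ) * ((N - s - c).descFactorial e : ℕ) := by
  rw [cast_descFactorial_eq_prod_range, cast_descFactorial_eq_prod_range, cast_descFactorial_eq_prod_range]
  simp only [eval_mul, eval_C, eval_prod, eval_sub, eval_X]
  have hs : ((t : ℝ) / 2 - (c : ℝ) * (1 / 2 : ℝ)) = s := by
    have : (t : ℝ) = 2 * s + c := by exact_mod_cast hsc.symm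
    rw [this]; ring
  have hm : ((N : ℝ) - (t : ℝ) / 2 - (c : ℝ) * (1 / 2 : ℝ)) = ((N - s - c : ℕ) : ℝ) := by
    have : (t : ℝ) = 2 * s + c := by exact_mod_cast hsc.symm
    rw [this, Nat.sub_sub, Nat.cast_sub hN]; push_cast; ring
  have e1 : ∏ i ∈ range f, ((t : ℝ) / 2 - i - 1 / 2 * (c : ℝ)) = ∏ i ∈ range f, ((s : ℝ) - i) := by
    refine prod_congr rfl fun i _ => ?_; rw [← hs]; ring
  have e3 : ∏ i ∈ range e, ((N : ℝ) - (t : ℝ) / 2 - i - 1 / 2 * (c : ℝ)) =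
      ∏ i ∈ range e, ((((N - s - c : ℕ)) : ℝ) - i) := by
    refine prod_congr rfl fun i _ => ?_; rw [← hm]; ring
  rw [e1, e3]

/-- **Vanishing below the number of half `HH`-edges**: `p_{fg}(c) = 0` for every natural `c < g` (the factor `X − c`);
in particular `p_{fg}(0) = 0` whenever `g ≥ 1` — the classes with a half internal edge carry NO virtual weight.
[cite: ChattamvelliShanmugam2020, §7.4 (multivariate hypergeometric law)] -/
theorem classWeight_eval_eq_zero_of_lt (κ T₀ M₀ : ℝ) (f g e : ℕ) {c : ℕ} (hc : c < g) :
    (C κ * (∏ i ∈ range f, (C (T₀ - i) - C (1 / 2 : ℝ) * X)) * (∏ i ∈ range g, (X - C (i : ℝ))) *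
        (∏ i ∈ range e, (C (M₀ - i) - C (1 / 2 : ℝ) * X))).eval (c : ℝ) = 0 := by
  simp only [eval_mul, eval_prod, eval_sub, eval_X, eval_C]
  have : ∏ i ∈ range g, ((c : ℝ) - (i : ℝ)) = 0 := prod_eq_zero (mem_range.2 hc) (by simp)
  rw [this]; ring

/-- **Sign at the virtual level for the classes without half `HH`-edges** (`g = 0`): with `t = 2s₀+1`, `f ≤ s₀ + 1`,
`e + s₀ ≤ N` and `κ ≥ 0`, `p_{f0}(0) = κ·Π_{i<f}(s₀ + ½ − i)·Π_{i<e}(N − s₀ − ½ − i) ≥ 0`.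
[cite: ChattamvelliShanmugam2020, §7.4 (multivariate hypergeometric law)] -/
theorem classWeight_eval_zero_nonneg {κ : ℝ} (hκ : 0 ≤ κ) {N s₀ f e : ℕ} (hf : f ≤ s₀ + 1) (he : e + s₀ ≤ N) :
    0 ≤ (C κ * (∏ i ∈ range f, (C (((2 * s₀ + 1 : ℕ) : ℝ) / 2 - i) - C (1 / 2 : ℝ) * X)) *
        (∏ i ∈ range 0, (X - C (i : ℝ))) *
        (∏ i ∈ range e, (C ((N : ℝ) - ((2 * s₀ + 1 : ℕ) : ℝ) / 2 - i) - C (1 / 2 : ℝ) * X))).eval 0 := by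
  simp only [eval_mul, eval_C, eval_prod, eval_sub, eval_X, prod_range_zero, mul_one, mul_zero, sub_zero]
  refine mul_nonneg (mul_nonneg hκ (prod_nonneg fun i hi => ?_)) (prod_nonneg fun i hi => ?_)
  · have hi' : (i : ℝ) + 1 ≤ f := by exact_mod_cast mem_range.1 hi
    have hf' : (f : ℝ) ≤ s₀ + 1 := by exact_mod_cast hf
    push_cast; linarith
  · have hi' : (i : ℝ) + 1 ≤ e := by exact_mod_cast mem_range.1 hi
    have he' : (e : ℝ) + s₀ ≤ N := by exact_mod_cast he
    push_cast; linarith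

/-- **Size on genuine levels**: with `κ = C(a,f)C(a−f,g)/(N)_a`, `f + g + e = a ≤ N`, `2s + c = t`, `s + c ≤ N`:
`0 ≤ p_{fg}(c) ≤ C(a,f)·C(a−f,g)` (the class weight is a probability: `(s)_f(c)_g(N−s−c)_e ≤ (N)_a`).
[cite: ChattamvelliShanmugam2020, §7.4 (multivariate hypergeometric law)] -/
theorem classWeight_eval_level_le {N t s c a f g e : ℕ} (hsc : 2 * s + c = t) (hN : s + c ≤ N)
    (hfge : f + g + e = a) (haN : a ≤ N) :
    0 ≤ (C (((a.choose f : ℕ) : ℝ) * ((a - f).choose g : ℕ) / (N.descFactorial a : ℕ)) *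
        (∏ i ∈ range f, (C ((t : ℝ) / 2 - i) - C (1 / 2 : ℝ) * X)) * (∏ i ∈ range g, (X - C (i : ℝ))) *
        (∏ i ∈ range e, (C ((N : ℝ) - (t : ℝ) / 2 - i) - C (1 / 2 : ℝ) * X))).eval (c : ℝ) ∧
    (C (((a.choose f : ℕ) : ℝ) * ((a - f).choose g : ℕ) / (N.descFactorial a : ℕ)) *
        (∏ i ∈ range f, (C ((t : ℝ) / 2 - i) - C (1 / 2 : ℝ) * X)) * (∏ i ∈ range g, (X - C (i : ℝ))) *
        (∏ i ∈ range e, (C ((N : ℝ) - (t : ℝ) / 2 - i) - C (1 / 2 : ℝ) * X))).eval (c : ℝ) ≤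
      ((a.choose f : ℕ) : ℝ) * ((a - f).choose g : ℕ) := by
  rw [classWeight_eval_level _ hsc hN]
  have hNa : 0 < N.descFactorial a := Nat.pos_of_ne_zero fun h => by
    rw [Nat.descFactorial_eq_zero_iff_lt] at h; omega
  have hNa' : (0 : ℝ) < (N.descFactorial a : ℕ) := by exact_mod_cast hNa
  have hle : s.descFactorial f * c.descFactorial g * (N - s - c).descFactorial e ≤ N.descFactorial a := by
    have h := descFactorial_mul_mul_le_add s c (N - s - c) f g e
    rwa [hfge, show s + c + (N - s - c) = N by omega] at h
  have hle' : ((s.descFactorial f : ℕ) : ℝ) * (c.descFactorial g : ℕ) * ((N - s - c).descFactorial e : ℕ) ≤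
      (N.descFactorial a : ℕ) := by exact_mod_cast hle
  constructor
  · positivity
  · rw [div_mul_eq_mul_div, div_mul_eq_mul_div, div_mul_eq_mul_div, div_le_iff₀ hNa']
    have h0 : (0 : ℝ) ≤ ((a.choose f : ℕ) : ℝ) * ((a - f).choose g : ℕ) := by positivity
    calc ((a.choose f : ℕ) : ℝ) * ((a - f).choose g : ℕ) * (s.descFactorial f : ℕ) * (c.descFactorial g : ℕ) *
          ((N - s - c).descFactorial e : ℕ)
        = ((a.choose f : ℕ) : ℝ) * ((a - f).choose g : ℕ) *
          (((s.descFactorial f : ℕ) : ℝ) * (c.descFactorial g : ℕ) * ((N - s - c).descFactorial e : ℕ)) := by ring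
      _ ≤ ((a.choose f : ℕ) : ℝ) * ((a - f).choose g : ℕ) * (N.descFactorial a : ℕ) :=
          mul_le_mul_of_nonneg_left hle' h0

end Summit.PneNP.PneNP.Theorems.ChebyshevTracialDesignSmallBlockClassWeights

end
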